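/-
COR-CM (cell pub-hodgecm2, stage 2 of the Hodge ladder) — junction B01 `PerLFace_of_PerL`, kernel part 1/2.
Seat prover-pub-hodgecm2-own-b01-0 (single owner of B01, COORDINATOR RULING «S6 RECORD-MOVE: GO» (vi), 2026-08-21).
Port (abstract, any universe `U`) of the last two steps of the stage-1 package engine
`HodgeCM.StubTree.thm44_of_realisation` (package `HodgeCM/Automorphic/Realisation.lean` ll. 176–327,
`HodgeCM/StubTree/PerLProof.lean` ll. 159–188): level change inside `U_Ψ(Γ)` and the multilinear expansion of a
non-zero period to pure pull-backs.  Theorems only; no definition, nothing cited, nothing asserted.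
-/
import Summits.HodgeConjecture.CorCM.Proofs.Prop22.Basic
import HarnessLib

/-!
# B01 kernel part 1: `U_Ψ(Γ)` under pull-back, and the multilinear expansion of the period

For a universe `U` (`CorCM/Geometry/Universe.lean`), a surface field `L` with `ι₁`, `(V₃,h)`, a one-form field `K`
with four CM types `Ψ i` and an eigen-embedding `σ`:

* `Universe.pullC_mem_Uiso` — `U_Ψ(Γ)` (`Universe.Uiso`: the span of the pull-backs `F^*α` of holomorphic
  `σ`-eigen one-forms `α` on `A_{(K,Ψ)}` along morphisms `F : P_Γ → A_{(K,Ψ)}`) is stable under pull-back along any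
  morphism of surfaces `g : P_{Γ'} → P_Γ` (uses `Fact_pull_comp` only: `(F ∘ g)^* = g^* F^*`);
* `Universe.Uiso_le_H10` — `U_Ψ(Γ) ⊆ H^{1,0}(P_Γ)` (uses `Fact_pull_hodge` only);
* `Universe.exists_mem_ne_zero_of_span` — a functional, additive and semilinear up to a scalar, that is non-zero
  on an element of a span is non-zero on a generator;
* `Universe.periodNV_of_period_ne_zero` — **multilinear expansion** (last step of PerL v5 Thm 4.4 / rfwf v3
  Thm 4.1): if four classes `ω i ∈ U_{Ψ i}(Γ)` have non-zero quadrilinear period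
  `∫ ω₀ ∧ ω₁ ∧ \overline{ω₂ ∧ ω₃}` (`Universe.period`), then some quadruple of PURE pull-backs `F_i^*α_i` has
  non-zero period, which is `U.PeriodNV ι₁ V K Ψ σ` verbatim.

These are the hypothesis-free (resp. `Fact_pull_comp` / `Fact_pull_hodge`-only) steps 4 and 6 of the package
engine; steps 1–3 and 5 (line field, `S₁₂ = S₃₄`, generation by (34)-wedges, Petersson = period) are the
automorphic content and appear in `CorCM/B01/FaceSkeleton.lean` as the two displayed face-scoped inputs of B01.
-/

noncomputable section

open scoped TensorProduct

namespace Summit.HodgeConjecture.CorCM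

open Literature.AlgebraicGeometry.Motives (CMType HodgeStructure)
open Literature.AlgebraicGeometry.Motives.HodgeStructure (EndAction conj)

namespace Universe

variable {U : Universe}

/-! ### `U_Ψ(Γ)` is pull-back stable and holomorphic -/

/-- **`U_Ψ` is stable under pull-back along any morphism of surfaces of the tower**: for
`g : P_{Γ'} → P_Γ` and `ω ∈ U_Ψ(Γ)`, `g^*ω ∈ U_Ψ(Γ')` (each generator `F^*α` goes to `(F ∘ g)^*α`;
`Fact_pull_comp`).  Port of the package's `HodgeCM.Universe.pullC_mem_Uiso`. [folklore] -/
theorem pullC_mem_Uiso (hc : U.Fact_pull_comp) {L : CMField} {ι₁ : L →+* ℂ} {V : HermSpace3 L ι₁}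
    {Γ Γ' : Level V} (g : U.Mor (U.pms L ι₁ V Γ') (U.pms L ι₁ V Γ)) (K : CMField) (Ψ : CMType K)
    (σ : K →+* ℂ) {ω : U.CohC (U.pms L ι₁ V Γ) 1} (hω : ω ∈ U.Uiso Γ K Ψ σ) :
    U.pullC g 1 ω ∈ U.Uiso Γ' K Ψ σ := by
  unfold Universe.Uiso at hω ⊢
  refine Submodule.span_induction (p := fun x _ => U.pullC g 1 x ∈ _) ?_ ?_ ?_ ?_ hω
  · rintro x ⟨F, α, hα, rfl⟩
    exact Submodule.subset_span ⟨U.comp g F, α, hα, (pullC_comp_apply hc g F 1 α).symm⟩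
  · rw [map_zero]; exact Submodule.zero_mem _
  · intro x y _ _ hx hy
    rw [map_add]
    exact Submodule.add_mem _ hx hy
  · intro c x _ hx
    rw [map_smul]
    exact Submodule.smul_mem _ c hx

/-- **`U_Ψ(Γ) ⊆ H^{1,0}(P_Γ)`**: the pull-back of a holomorphic `σ`-eigen one-form (`alphaLine ≤ piece 1 0`) is a
`(1,0)`-class (`Fact_pull_hodge`; `conj` commutes with pull-back).  Port of the package's
`HodgeCM.Universe.Uiso_le_H10`. [folklore] -/
theorem Uiso_le_piece10 (hH : U.Fact_pull_hodge) {L : CMField} {ι₁ : L →+* ℂ} {V : HermSpace3 L ι₁}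
    (Γ : Level V) (K : CMField) (Ψ : CMType K) (σ : K →+* ℂ) :
    U.Uiso Γ K Ψ σ ≤ (U.hodge (U.pms L ι₁ V Γ) 1).piece 1 0 := by
  refine Submodule.span_le.mpr ?_
  rintro ω ⟨F, α, hα, rfl⟩
  have hα' : α ∈ (U.hodge (U.cmAV K Ψ) 1).piece 1 0 := EndAction.eigenPiece_le_piece _ _ _ _ hα
  rw [HodgeStructure.mem_piece_iff _ (by norm_num)] at hα'
  show U.pullC F 1 α ∈ (U.hodge (U.pms L ι₁ V Γ) 1).piece 1 0
  rw [HodgeStructure.mem_piece_iff _ (by norm_num)]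
  refine ⟨hH _ _ F 1 1 (Submodule.mem_map_of_mem hα'.1), ?_⟩
  rw [conj_pullC]
  exact hH _ _ F 1 0 (Submodule.mem_map_of_mem hα'.2)

/-! ### Multilinear expansion -/

/-- Expansion step: a functional that is additive, semilinear up to a scalar factor, and non-zero at some element of
a span is non-zero at some generator of the span.  Port of the package lemma of the same name. [folklore] -/
theorem exists_mem_ne_zero_of_span {M : Type*} [AddCommGroup M] [Module ℂ M] {φ : M → ℂ}
    (hadd : ∀ x y, φ (x + y) = φ x + φ y) (hsmul : ∀ (c : ℂ) (x : M), ∃ d : ℂ, φ (c • x) = d * φ x)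
    {s : Set M} {ω : M} (hω : ω ∈ Submodule.span ℂ s) (hne : φ ω ≠ 0) : ∃ x ∈ s, φ x ≠ 0 := by
  by_contra h
  simp only [not_exists, not_and, not_not] at h
  have key : ∀ ω ∈ Submodule.span ℂ s, φ ω = 0 := by
    intro ω hω
    induction hω using Submodule.span_induction with
    | mem x hx => exact h x hx
    | zero =>
      have h0 := hadd 0 0
      rw [add_zero] at h0
      simpa using h0
    | add x y _ _ hx hy => rw [hadd, hx, hy, add_zero]
    | smul c x _ hx =>
      obtain ⟨d, hd⟩ := hsmul c x
      rw [hd, hx, mul_zero]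
  exact hne (key ω hω)

/-- **Multilinear expansion** (last step of PerL v5 Thm 4.4 = rfwf v3 Thm 4.1): if four classes `ω i ∈ U_{Ψ i}(Γ)`
— finite `ℂ`-combinations of pure pull-backs `F^*α` of holomorphic `σ`-eigen one-forms — have non-zero period
`∫_{P_Γ} ω₀ ∧ ω₁ ∧ \overline{ω₂ ∧ ω₃}`, then some quadruple of PURE pull-backs has non-zero period, i.e.
`U.PeriodNV ι₁ V K Ψ σ` holds (the period is `ℂ`-linear in slots 0, 1 and antilinear in slots 2, 3).  Port of the
package's `HodgeCM.Universe.periodNV_of_period_ne_zero`; hypothesis-free. [folklore] -/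
theorem periodNV_of_period_ne_zero {L : CMField} {ι₁ : L →+* ℂ} {V : HermSpace3 L ι₁} {K : CMField}
    {Ψ : Fin 4 → CMType K} {σ : K →+* ℂ} (Γ : Level V) (ω : Fin 4 → U.CohC (U.pms L ι₁ V Γ) 1)
    (hU : ∀ i, ω i ∈ U.Uiso Γ K (Ψ i) σ) (hper : U.period (U.pms L ι₁ V Γ) ω ≠ 0) :
    U.PeriodNV ι₁ V K Ψ σ := by
  -- the period as a function of four separate slots
  let P : U.CohC (U.pms L ι₁ V Γ) 1 → U.CohC (U.pms L ι₁ V Γ) 1 → U.CohC (U.pms L ι₁ V Γ) 1 →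
      U.CohC (U.pms L ι₁ V Γ) 1 → ℂ :=
    fun a b c d => U.trC _ 4 (U.quadC _ a b (conj c) (conj d))
  have hP : U.period (U.pms L ι₁ V Γ) ω = P (ω 0) (ω 1) (ω 2) (ω 3) := rfl
  have add₀ : ∀ a a' b c d, P (a + a') b c d = P a b c d + P a' b c d := fun a a' b c d => by
    simp only [P, Universe.quadC, map_add, LinearMap.add_apply]
  have add₁ : ∀ a b b' c d, P a (b + b') c d = P a b c d + P a b' c d := fun a b b' c d => by
    simp only [P, Universe.quadC, map_add, LinearMap.add_apply]
  have add₂ : ∀ a b c c' d, P a b (c + c') d = P a b c d + P a b c' d := fun a b c c' d => by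
    simp only [P, Universe.quadC, map_add, LinearMap.add_apply]
  have add₃ : ∀ a b c d d', P a b c (d + d') = P a b c d + P a b c d' := fun a b c d d' => by
    simp only [P, Universe.quadC, map_add]
  have smul₀ : ∀ (r : ℂ) a b c d, P (r • a) b c d = r * P a b c d := fun r a b c d => by
    simp only [P, Universe.quadC, map_smul, LinearMap.smul_apply, smul_eq_mul]
  have smul₁ : ∀ (r : ℂ) a b c d, P a (r • b) c d = r * P a b c d := fun r a b c d => by
    simp only [P, Universe.quadC, map_smul, LinearMap.smul_apply, smul_eq_mul]
  have smul₂ : ∀ (r : ℂ) a b c d, P a b (r • c) d = starRingEnd ℂ r * P a b c d := fun r a b c d => by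
    simp only [P, Universe.quadC, HodgeStructure.conj_smul, map_smul, LinearMap.smul_apply, smul_eq_mul]
  have smul₃ : ∀ (r : ℂ) a b c d, P a b c (r • d) = starRingEnd ℂ r * P a b c d := fun r a b c d => by
    simp only [P, Universe.quadC, HodgeStructure.conj_smul, map_smul, smul_eq_mul]
  have hU' : ∀ i, ω i ∈ Submodule.span ℂ {x : U.CohC (U.pms L ι₁ V Γ) 1 |
      ∃ (F : U.Mor (U.pms L ι₁ V Γ) (U.cmAV K (Ψ i))) (α : U.CohC (U.cmAV K (Ψ i)) 1),
        α ∈ U.alphaLine K (Ψ i) σ ∧ x = U.pullC F 1 α} := hU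
  rw [hP] at hper
  -- slot 0
  obtain ⟨a, ha, h0⟩ := exists_mem_ne_zero_of_span (φ := fun x => P x (ω 1) (ω 2) (ω 3))
    (fun x y => add₀ x y _ _ _) (fun r x => ⟨r, smul₀ r x _ _ _⟩) (hU' 0) hper
  -- slot 1
  obtain ⟨b, hb, h1⟩ := exists_mem_ne_zero_of_span (φ := fun x => P a x (ω 2) (ω 3))
    (fun x y => add₁ a x y _ _) (fun r x => ⟨r, smul₁ r a x _ _⟩) (hU' 1) h0
  -- slot 2
  obtain ⟨c, hc, h2⟩ := exists_mem_ne_zero_of_span (φ := fun x => P a b x (ω 3))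
    (fun x y => add₂ a b x y _) (fun r x => ⟨starRingEnd ℂ r, smul₂ r a b x _⟩) (hU' 2) h1
  -- slot 3
  obtain ⟨d, hd, h3⟩ := exists_mem_ne_zero_of_span (φ := fun x => P a b c x)
    (fun x y => add₃ a b c x y) (fun r x => ⟨starRingEnd ℂ r, smul₃ r a b c x⟩) (hU' 3) h2
  -- assemble the pure quadruple
  let ω' : Fin 4 → U.CohC (U.pms L ι₁ V Γ) 1 := fun i => match i with | 0 => a | 1 => b | 2 => c | 3 => d
  have hP' : ∀ i, ∃ (F : U.Mor (U.pms L ι₁ V Γ) (U.cmAV K (Ψ i))) (α : U.CohC (U.cmAV K (Ψ i)) 1),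
      α ∈ U.alphaLine K (Ψ i) σ ∧ ω' i = U.pullC F 1 α := by
    intro i
    match i with
    | 0 => exact ha
    | 1 => exact hb
    | 2 => exact hc
    | 3 => exact hd
  choose F α hα hω' using hP'
  refine ⟨Γ, F, α, hα, ?_⟩
  have e : (fun i => U.pullC (F i) 1 (α i)) = ω' := funext fun i => (hω' i).symm
  rw [e]
  exact h3

/-- **Level change + expansion**: if `ω₀ ∈ U_{Ψ₀}(Γ)`, `ω₁ ∈ U_{Ψ₁}(Γ)` at one level and `ω₂ ∈ U_{Ψ₂}(Γ')`,
`ω₃ ∈ U_{Ψ₃}(Γ')` at a level `Γ'` mapping to it by `g : P_{Γ'} → P_Γ`, and the period at level `Γ'` of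
`(g^*ω₀, g^*ω₁, ω₂, ω₃)` is non-zero, then `U.PeriodNV ι₁ V K Ψ σ` (steps 4 + 6 of the package engine;
`Fact_pull_comp` only). [folklore] -/
theorem periodNV_of_coupled_levels (hc : U.Fact_pull_comp) {L : CMField} {ι₁ : L →+* ℂ} {V : HermSpace3 L ι₁}
    {K : CMField} {Ψ : Fin 4 → CMType K} {σ : K →+* ℂ} {Γ Γ' : Level V}
    (g : U.Mor (U.pms L ι₁ V Γ') (U.pms L ι₁ V Γ))
    {ω₀ ω₁ : U.CohC (U.pms L ι₁ V Γ) 1} {ω₂ ω₃ : U.CohC (U.pms L ι₁ V Γ') 1}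
    (h₀ : ω₀ ∈ U.Uiso Γ K (Ψ 0) σ) (h₁ : ω₁ ∈ U.Uiso Γ K (Ψ 1) σ)
    (h₂ : ω₂ ∈ U.Uiso Γ' K (Ψ 2) σ) (h₃ : ω₃ ∈ U.Uiso Γ' K (Ψ 3) σ)
    (hper : U.period (U.pms L ι₁ V Γ') ![U.pullC g 1 ω₀, U.pullC g 1 ω₁, ω₂, ω₃] ≠ 0) :
    U.PeriodNV ι₁ V K Ψ σ := by
  refine periodNV_of_period_ne_zero Γ' _ (fun i => ?_) hper
  match i with
  | 0 => exact pullC_mem_Uiso hc g K (Ψ 0) σ h₀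
  | 1 => exact pullC_mem_Uiso hc g K (Ψ 1) σ h₁
  | 2 => exact h₂
  | 3 => exact h₃

end Universe

end Summit.HodgeConjecture.CorCM

end
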